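import Literature.NumberTheory.LFunctions.KMVAfeWeightRealForm
import Literature.NumberTheory.LFunctions.KMVCutoffW
import Mathlib.Analysis.SpecificLimits.Normed
import Mathlib.MeasureTheory.Integral.DominatedConvergence
import HarnessLib

/-!
# Route `PrimeLevelFamEdge`, crux K_A `MomentsBeyondDiagonal` (stmt-Parity-20007), line «petersson_layers» v4,
# registered stub `stub_diag : SubDiag` — THE EXACT `t`-SUMMATION OF THE ORDER-`(i, j)` WEIGHT ALONG A DIAGONAL LINE

After `…MomentsBeyondDiagonalDiagLines` (p810970) the diagonal part `diagPart` is a sum over mollifier pairs, Hecke divisors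
and ONE line parameter `t ≥ 1`, with summand (closed real form, `weight_line_eq_logCutoffW`)
`c (ab)^{−1/2} · t⁻¹ 𝒲_{ij}(A₁ − log t, A₂ − log t; y t²)`, `𝒲_{ij} = KMV2000.logCutoffW i j`
(`= ∫∫_{x₁x₂ > y t²} e^{−x₁−x₂}(A₁ − log t + log x₁)^i (A₂ − log t + log x₂)^j`), `A_ν = log(q̂/(d_ν e_ν))`, `y = K/q̂²`.
This file sums the line parameter EXACTLY (the order-`(i,j)` analogue of the K_B bridge
`Corner.scriptW_eq_tsum_cutoffW`: `Σ_{l≥1} W(l²y)/l = ∫_0^∞ dv/(e^{v+y/v} − 1)`):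

* §1 `logCutoffW_scale` — scaling `x_ν = t u_ν` in the real form: the `log t` CANCELS against the shifts,
  `𝒲_{ij}(A₁ − log t, A₂ − log t; y t²) = t² ∫_{u₁>0} e^{−t u₁}(A₁ + log u₁)^i ∫_{u₂ > y/u₁} e^{−t u₂}(A₂ + log u₂)^j du₂ du₁`
  (`t > 0`, `y ≥ 0`): the region `u₁u₂ > y` no longer depends on `t`.
* §2 `hasSum_inv_mul_logCutoffW` — summing `t = l + 1 ≥ 1` with `Σ_{t≥1} t e^{−tφ} = e^{−φ}/(1 − e^{−φ})²`, `φ = u₁ + u₂ > 0`: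
  `Σ_{t ≥ 1} t⁻¹ 𝒲_{ij}(A₁ − log t, A₂ − log t; y t²)
     = ∫_{u₁>0} (A₁ + log u₁)^i ∫_{u₂ > y/u₁} e^{−(u₁+u₂)} (1 − e^{−(u₁+u₂)})^{−2} (A₂ + log u₂)^j du₂ du₁`   (`y > 0`),
  an absolutely convergent double integral over the FIXED region `u₁u₂ > y` against the Bose-type kernel
  `e^{−φ}/(1−e^{−φ})² = Σ_{t≥1} t e^{−tφ}`; at `i = j = 0` the inner integral is `1/(e^{u₁ + y/u₁} − 1)` and this is
  `Corner.scriptW y`. So the FULL line series of the order-`(i,j)` diagonal is `c (ab)^{−1/2}` times this double integral,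
  a polynomial of bidegree `(i, j)` in `(A₁, A₂)` whose coefficients are functions of `y = K/q̂²` alone.
Pure real analysis; no arithmetic, no main-term estimate. Helper `--supports stmt-Parity-20007`; closes nothing; K_A, K_B and
the Parity summit are NOT proved; nothing about Landau–Siegel zeros.
-/

noncomputable section

open Real Set MeasureTheory Filter Topology
open Literature.NumberTheory.LFunctions

namespace Summit.Parity.GeneralizedHardyLittlewood.Theorems.MomentsBeyondDiagonal.DiagLines

/-! ## §0. Integrability of `e^{−x}(A + log x)^j` -/

/-- `x ↦ e^{−x}(A + log x)^j` is integrable on `(0, ∞)` (the tree's `KMV2000.integrableOn_expLogPow` at `c = e^A`).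
[cite: KowalskiMichelVanderKam2000, (13) p. 9] -/
theorem integrableOn_exp_neg_mul_logPow (A : ℝ) (j : ℕ) :
    IntegrableOn (fun x : ℝ ↦ Real.exp (-x) * (A + Real.log x) ^ j) (Ioi 0) := by
  have h := KMV2000.integrableOn_expLogPow (Real.exp_pos A) j
  simpa only [Real.log_exp] using h

/-- The same with the absolute value: `x ↦ e^{−x}|A + log x|^j` is integrable on `(0, ∞)`. [cite: KowalskiMichelVanderKam2000, (13) p. 9] -/
theorem integrableOn_exp_neg_mul_abs_logPow (A : ℝ) (j : ℕ) :
    IntegrableOn (fun x : ℝ ↦ Real.exp (-x) * |A + Real.log x| ^ j) (Ioi 0) := by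
  have h : IntegrableOn (fun x : ℝ ↦ ‖Real.exp (-x) * (A + Real.log x) ^ j‖) (Ioi 0) :=
    (integrableOn_exp_neg_mul_logPow A j).norm
  refine h.congr_fun (fun x _ ↦ ?_) measurableSet_Ioi
  simp only [Real.norm_eq_abs, abs_mul, abs_of_pos (Real.exp_pos _), abs_pow]

/-! ## §1. Scaling: the `log t` cancels -/

/-- Inner scaling: for `t > 0`, `z ≥ 0`,
`∫_{x > t z} e^{−x}(A − log t + log x)^j dx = t ∫_{u > z} e^{−t u}(A + log u)^j du` (`x = t u`). [folklore] -/
theorem integral_tail_scale {t : ℝ} (ht : 0 < t) (A : ℝ) (j : ℕ) {z : ℝ} (hz : 0 ≤ z) :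
    ∫ x in Ioi (t * z), Real.exp (-x) * (A - Real.log t + Real.log x) ^ j =
      t * ∫ u in Ioi z, Real.exp (-(t * u)) * (A + Real.log u) ^ j := by
  have hsub := MeasureTheory.integral_comp_mul_left_Ioi
    (fun x : ℝ ↦ Real.exp (-x) * (A - Real.log t + Real.log x) ^ j) z ht
  simp only [smul_eq_mul] at hsub
  have hcongr : ∫ u in Ioi z, Real.exp (-(t * u)) * (A - Real.log t + Real.log (t * u)) ^ j =
      ∫ u in Ioi z, Real.exp (-(t * u)) * (A + Real.log u) ^ j := by
    refine setIntegral_congr_fun measurableSet_Ioi fun u hu ↦ ?_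
    have hu : 0 < u := lt_of_le_of_lt hz hu
    rw [Real.log_mul ht.ne' hu.ne']
    ring_nf
  rw [← hcongr, hsub, ← mul_assoc, mul_inv_cancel₀ ht.ne', one_mul]

/-- **§1. Scaling of the real form: the `log t` cancels.** For `t > 0`, `y ≥ 0`, all real `A₁, A₂` and orders `i, j`:
`𝒲_{ij}(A₁ − log t, A₂ − log t; y t²) = t² ∫_{u₁>0} e^{−t u₁}(A₁ + log u₁)^i ( ∫_{u₂ > y/u₁} e^{−t u₂}(A₂ + log u₂)^j du₂ ) du₁`
(`𝒲_{ij} = KMV2000.logCutoffW i j`; substitute `x_ν = t u_ν`; the region becomes `u₁u₂ > y`, free of `t`).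
[cite: KowalskiMichelVanderKam2000, (21)–(23) p. 12–13 — derivation] -/
theorem logCutoffW_scale {t : ℝ} (ht : 0 < t) (i j : ℕ) (A₁ A₂ : ℝ) {y : ℝ} (hy : 0 ≤ y) :
    KMV2000.logCutoffW i j (A₁ - Real.log t) (A₂ - Real.log t) (y * t ^ 2) =
      t ^ 2 * ∫ u₁ in Ioi (0 : ℝ), Real.exp (-(t * u₁)) * (A₁ + Real.log u₁) ^ i *
        ∫ u₂ in Ioi (y / u₁), Real.exp (-(t * u₂)) * (A₂ + Real.log u₂) ^ j := by
  unfold KMV2000.logCutoffW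
  -- outer substitution `x₁ = t u₁`
  have hsub := MeasureTheory.integral_comp_mul_left_Ioi
    (fun x₁ : ℝ ↦ Real.exp (-x₁) * (A₁ - Real.log t + Real.log x₁) ^ i *
      ∫ x₂ in Ioi (y * t ^ 2 / x₁), Real.exp (-x₂) * (A₂ - Real.log t + Real.log x₂) ^ j) 0 ht
  simp only [mul_zero, smul_eq_mul] at hsub
  have hmain : ∫ u₁ in Ioi (0 : ℝ), Real.exp (-(t * u₁)) * (A₁ - Real.log t + Real.log (t * u₁)) ^ i *
        ∫ x₂ in Ioi (y * t ^ 2 / (t * u₁)), Real.exp (-x₂) * (A₂ - Real.log t + Real.log x₂) ^ j =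
      ∫ u₁ in Ioi (0 : ℝ), Real.exp (-(t * u₁)) * (A₁ + Real.log u₁) ^ i *
        (t * ∫ u₂ in Ioi (y / u₁), Real.exp (-(t * u₂)) * (A₂ + Real.log u₂) ^ j) := by
    refine setIntegral_congr_fun measurableSet_Ioi fun u₁ hu₁ ↦ ?_
    have hu₁ : 0 < u₁ := hu₁
    have hz : 0 ≤ y / u₁ := div_nonneg hy hu₁.le
    have harg : y * t ^ 2 / (t * u₁) = t * (y / u₁) := by field_simp
    rw [Real.log_mul ht.ne' hu₁.ne', harg, integral_tail_scale ht A₂ j hz]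
    ring_nf
  have hpull : ∫ u₁ in Ioi (0 : ℝ), Real.exp (-(t * u₁)) * (A₁ + Real.log u₁) ^ i *
        (t * ∫ u₂ in Ioi (y / u₁), Real.exp (-(t * u₂)) * (A₂ + Real.log u₂) ^ j) =
      t * ∫ u₁ in Ioi (0 : ℝ), Real.exp (-(t * u₁)) * (A₁ + Real.log u₁) ^ i *
        ∫ u₂ in Ioi (y / u₁), Real.exp (-(t * u₂)) * (A₂ + Real.log u₂) ^ j := by
    rw [← integral_const_mul]
    refine setIntegral_congr_fun measurableSet_Ioi fun u₁ _ ↦ ?_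
    ring
  have hinv : ∫ x₁ in Ioi (0 : ℝ), Real.exp (-x₁) * (A₁ - Real.log t + Real.log x₁) ^ i *
        ∫ x₂ in Ioi (y * t ^ 2 / x₁), Real.exp (-x₂) * (A₂ - Real.log t + Real.log x₂) ^ j =
      t * ∫ u₁ in Ioi (0 : ℝ), Real.exp (-(t * u₁)) * (A₁ - Real.log t + Real.log (t * u₁)) ^ i *
        ∫ x₂ in Ioi (y * t ^ 2 / (t * u₁)), Real.exp (-x₂) * (A₂ - Real.log t + Real.log x₂) ^ j := by
    rw [hsub, ← mul_assoc, mul_inv_cancel₀ ht.ne', one_mul]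
  rw [hinv, hmain, hpull]
  ring

/-- **§1, per line parameter.** For `t > 0`, `y ≥ 0`:
`t⁻¹ 𝒲_{ij}(A₁ − log t, A₂ − log t; y t²) = t ∫_{u₁>0} e^{−t u₁}(A₁+log u₁)^i ∫_{u₂>y/u₁} e^{−t u₂}(A₂+log u₂)^j` — the
summand of the line series with its `t`-dependence made explicit. [cite: KowalskiMichelVanderKam2000, (21)–(23) p. 12–13 — derivation] -/
theorem inv_mul_logCutoffW_scale {t : ℝ} (ht : 0 < t) (i j : ℕ) (A₁ A₂ : ℝ) {y : ℝ} (hy : 0 ≤ y) :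
    t⁻¹ * KMV2000.logCutoffW i j (A₁ - Real.log t) (A₂ - Real.log t) (y * t ^ 2) =
      t * ∫ u₁ in Ioi (0 : ℝ), Real.exp (-(t * u₁)) * (A₁ + Real.log u₁) ^ i *
        ∫ u₂ in Ioi (y / u₁), Real.exp (-(t * u₂)) * (A₂ + Real.log u₂) ^ j := by
  rw [logCutoffW_scale ht i j A₁ A₂ hy, ← mul_assoc, pow_two, ← mul_assoc, inv_mul_cancel₀ ht.ne', one_mul]

/-! ## §2. Summing the line parameter: the Bose-type kernel `e^{−φ}/(1 − e^{−φ})² = Σ_{t≥1} t e^{−tφ}` -/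

/-- Continuity of the scaled tail `z ↦ ∫_{u>z} e^{−Tu}(A + log u)^j du` at every `z₀ > 0` (`T > 0`; from the tree's
`KMV2000.continuousAt_tail` after `x = Tu`). [cite: KowalskiMichelVanderKam2000, (22) p. 12] -/
theorem continuousAt_expTail {T : ℝ} (hT : 0 < T) (A : ℝ) (j : ℕ) {z₀ : ℝ} (hz₀ : 0 < z₀) :
    ContinuousAt (fun z : ℝ ↦ ∫ u in Ioi z, Real.exp (-(T * u)) * (A + Real.log u) ^ j) z₀ := by
  set c : ℝ := Real.exp (A - Real.log T) with hc
  have hc0 : 0 < c := Real.exp_pos _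
  have hlogc : Real.log c = A - Real.log T := Real.log_exp _
  -- on `z ≥ 0` the scaled tail is `T⁻¹ · tail_c(Tz)`
  have hev : (fun z : ℝ ↦ ∫ u in Ioi z, Real.exp (-(T * u)) * (A + Real.log u) ^ j) =ᶠ[𝓝 z₀]
      fun z : ℝ ↦ T⁻¹ * ∫ x in Ioi (T * z), Real.exp (-x) * (Real.log c + Real.log x) ^ j := by
    filter_upwards [Ioi_mem_nhds hz₀] with z hz
    have hz : 0 < z := hz
    rw [hlogc, integral_tail_scale hT A j hz.le, ← mul_assoc, inv_mul_cancel₀ hT.ne', one_mul]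
  refine ContinuousAt.congr ?_ hev.symm
  have htail := KMV2000.continuousAt_tail hc0 j (mul_pos hT hz₀)
  have hlin : ContinuousAt (fun z : ℝ ↦ T * z) z₀ := by fun_prop
  exact (ContinuousAt.comp (g := fun w : ℝ ↦ ∫ x in Ioi w, Real.exp (-x) * (Real.log c + Real.log x) ^ j)
    htail hlin).const_mul T⁻¹

/-- The scaled tail over `u₂ > z > 0` is bounded by `e^{−(T−1)z} ∫_0^∞ e^{−u}|A + log u|^j` for `T ≥ 1`. [folklore] -/
theorem norm_expTail_le {T : ℝ} (hT : 1 ≤ T) (A : ℝ) (j : ℕ) {z : ℝ} (hz : 0 < z) :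
    ‖∫ u in Ioi z, Real.exp (-(T * u)) * (A + Real.log u) ^ j‖ ≤
      Real.exp (-((T - 1) * z)) * ∫ u in Ioi (0 : ℝ), Real.exp (-u) * |A + Real.log u| ^ j := by
  have hint := integrableOn_exp_neg_mul_abs_logPow A j
  have hintz : IntegrableOn (fun u : ℝ ↦ Real.exp (-u) * |A + Real.log u| ^ j) (Ioi z) :=
    hint.mono_set (Ioi_subset_Ioi hz.le)
  have hptw : ∀ u ∈ Ioi z, ‖Real.exp (-(T * u)) * (A + Real.log u) ^ j‖ ≤
      Real.exp (-((T - 1) * z)) * (Real.exp (-u) * |A + Real.log u| ^ j) := by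
    intro u hu
    have hu : z < u := hu
    have hu0 : 0 ≤ u := (hz.trans hu).le
    rw [norm_mul, Real.norm_of_nonneg (Real.exp_pos _).le, norm_pow, Real.norm_eq_abs]
    have hexp : Real.exp (-(T * u)) ≤ Real.exp (-((T - 1) * z)) * Real.exp (-u) := by
      rw [← Real.exp_add]
      exact Real.exp_le_exp.mpr (by nlinarith)
    calc Real.exp (-(T * u)) * |A + Real.log u| ^ j
        ≤ Real.exp (-((T - 1) * z)) * Real.exp (-u) * |A + Real.log u| ^ j :=
          mul_le_mul_of_nonneg_right hexp (pow_nonneg (abs_nonneg _) _)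
      _ = _ := by ring
  have hfint : IntegrableOn (fun u : ℝ ↦ Real.exp (-(T * u)) * (A + Real.log u) ^ j) (Ioi z) := by
    refine Integrable.mono' (hintz.const_mul (Real.exp (-((T - 1) * z))))
      ((ContinuousOn.mul (by fun_prop) (ContinuousOn.pow (continuousOn_const.add
        (Real.continuousOn_log.mono fun x hx ↦ ne_of_gt (lt_trans hz hx))) j)).aestronglyMeasurable
        measurableSet_Ioi) ?_
    rw [ae_restrict_iff' measurableSet_Ioi]
    exact ae_of_all _ hptw
  calc ‖∫ u in Ioi z, Real.exp (-(T * u)) * (A + Real.log u) ^ j‖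
      ≤ ∫ u in Ioi z, ‖Real.exp (-(T * u)) * (A + Real.log u) ^ j‖ := norm_integral_le_integral_norm _
    _ ≤ ∫ u in Ioi z, Real.exp (-((T - 1) * z)) * (Real.exp (-u) * |A + Real.log u| ^ j) :=
        setIntegral_mono_on hfint.norm (hintz.const_mul _) measurableSet_Ioi hptw
    _ = Real.exp (-((T - 1) * z)) * ∫ u in Ioi z, Real.exp (-u) * |A + Real.log u| ^ j :=
        integral_const_mul _ _
    _ ≤ Real.exp (-((T - 1) * z)) * ∫ u in Ioi (0 : ℝ), Real.exp (-u) * |A + Real.log u| ^ j := by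
        refine mul_le_mul_of_nonneg_left ?_ (Real.exp_pos _).le
        exact setIntegral_mono_set hint (ae_of_all _ fun u ↦ by positivity) (ae_of_all _ (Ioi_subset_Ioi hz.le))

/-- Integrability of the scaled inner integrand on `u₂ > z > 0` (`T ≥ 1`). [folklore] -/
theorem integrableOn_expInner {T : ℝ} (hT : 1 ≤ T) (A : ℝ) (j : ℕ) {z : ℝ} (hz : 0 < z) (u₁ : ℝ) :
    IntegrableOn (fun u : ℝ ↦ T * Real.exp (-(T * (u₁ + u))) * (A + Real.log u) ^ j) (Ioi z) := by
  have hint := integrableOn_exp_neg_mul_abs_logPow A j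
  have hintz : IntegrableOn (fun u : ℝ ↦ Real.exp (-u) * |A + Real.log u| ^ j) (Ioi z) :=
    hint.mono_set (Ioi_subset_Ioi hz.le)
  refine Integrable.mono' (hintz.const_mul (T * Real.exp (-(T * u₁))))
    ((ContinuousOn.mul (by fun_prop) (ContinuousOn.pow (continuousOn_const.add
      (Real.continuousOn_log.mono fun x hx ↦ ne_of_gt (lt_trans hz hx))) j)).aestronglyMeasurable
      measurableSet_Ioi) ?_
  rw [ae_restrict_iff' measurableSet_Ioi]
  refine ae_of_all _ fun u (hu : z < u) ↦ ?_
  have hu0 : 0 ≤ u := (hz.trans hu).le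
  have hT0 : 0 ≤ T := by linarith
  rw [norm_mul, norm_mul, Real.norm_of_nonneg hT0, Real.norm_of_nonneg (Real.exp_pos _).le, norm_pow,
    Real.norm_eq_abs]
  have hexp : Real.exp (-(T * (u₁ + u))) ≤ Real.exp (-(T * u₁)) * Real.exp (-u) := by
    rw [← Real.exp_add]
    exact Real.exp_le_exp.mpr (by nlinarith)
  calc T * Real.exp (-(T * (u₁ + u))) * |A + Real.log u| ^ j
      ≤ T * (Real.exp (-(T * u₁)) * Real.exp (-u)) * |A + Real.log u| ^ j := by gcongr
    _ = _ := by ring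

/-- **The Bose-type kernel**: for `φ > 0`, `Σ_{l ≥ 0} (l+1) e^{−(l+1)φ} = e^{−φ}/(1 − e^{−φ})²`. [folklore] -/
theorem hasSum_succ_mul_exp_neg {φ : ℝ} (hφ : 0 < φ) :
    HasSum (fun l : ℕ ↦ ((l : ℝ) + 1) * Real.exp (-(((l : ℝ) + 1) * φ)))
      (Real.exp (-φ) / (1 - Real.exp (-φ)) ^ 2) := by
  set r : ℝ := Real.exp (-φ) with hr
  have hr1 : ‖r‖ < 1 := by
    rw [Real.norm_of_nonneg (Real.exp_pos _).le]
    exact Real.exp_lt_one_iff.mpr (by linarith)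
  have h0 := hasSum_coe_mul_geometric_of_norm_lt_one hr1
  have h1 := (hasSum_nat_add_iff' 1).mpr h0
  simp only [Finset.range_one, Finset.sum_singleton, Nat.cast_zero, pow_zero, mul_one, sub_zero,
    Nat.cast_add, Nat.cast_one] at h1
  have hfun : (fun l : ℕ ↦ ((l : ℝ) + 1) * Real.exp (-(((l : ℝ) + 1) * φ))) =
      fun n : ℕ ↦ ((n : ℝ) + 1) * r ^ (n + 1) := by
    funext l
    rw [hr, ← Real.exp_nat_mul]
    congr 2
    push_cast
    ring
  rw [hfun]
  exact h1

/-- **§2. THE EXACT `t`-SUMMATION OF THE ORDER-`(i,j)` LINE SERIES.** For `y > 0`, real `A₁, A₂` and orders `i, j`: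
`Σ_{l ≥ 0} (l+1)⁻¹ 𝒲_{ij}(A₁ − log(l+1), A₂ − log(l+1); y (l+1)²)
   = ∫_{u₁>0} (A₁ + log u₁)^i ∫_{u₂ > y/u₁} e^{−(u₁+u₂)} (1 − e^{−(u₁+u₂)})^{−2} (A₂ + log u₂)^j du₂ du₁`
(`𝒲_{ij} = KMV2000.logCutoffW i j`): scale (§1), sum the Bose-type kernel, interchange by absolute convergence
(`∫‖term_l‖ ≤ (l+1)e^{−l√y} · ∫e^{−u}|A₁+log u|^i · ∫e^{−u}|A₂+log u|^j`). At `i = j = 0` the right-hand side is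
`∫_0^∞ du₁/(e^{u₁ + y/u₁} − 1) = Corner.scriptW y`. [cite: KowalskiMichelVanderKam2000, (21)–(23) p. 12–13 and Prop. 5.1 — derivation (real form of the order-(i,j) diagonal weight)] -/
theorem hasSum_inv_mul_logCutoffW {y : ℝ} (hy : 0 < y) (i j : ℕ) (A₁ A₂ : ℝ) :
    HasSum (fun l : ℕ ↦ ((l : ℝ) + 1)⁻¹ *
        KMV2000.logCutoffW i j (A₁ - Real.log ((l : ℝ) + 1)) (A₂ - Real.log ((l : ℝ) + 1)) (y * ((l : ℝ) + 1) ^ 2))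
      (∫ u₁ in Ioi (0 : ℝ), (A₁ + Real.log u₁) ^ i *
        ∫ u₂ in Ioi (y / u₁), Real.exp (-(u₁ + u₂)) / (1 - Real.exp (-(u₁ + u₂))) ^ 2 * (A₂ + Real.log u₂) ^ j) := by
  set M₁ : ℝ := ∫ u in Ioi (0 : ℝ), Real.exp (-u) * |A₁ + Real.log u| ^ i with hM₁
  set M₂ : ℝ := ∫ u in Ioi (0 : ℝ), Real.exp (-u) * |A₂ + Real.log u| ^ j with hM₂
  have hM₂0 : 0 ≤ M₂ := setIntegral_nonneg measurableSet_Ioi fun u _ ↦ by positivity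
  set ρ : ℝ := Real.exp (-Real.sqrt y) with hρ
  have hρ0 : 0 ≤ ρ := (Real.exp_pos _).le
  have hρ1 : ρ < 1 := Real.exp_lt_one_iff.mpr (by linarith [Real.sqrt_pos.mpr hy])
  -- the outer integrands
  set G : ℕ → ℝ → ℝ := fun l u₁ ↦ (A₁ + Real.log u₁) ^ i * ((((l : ℝ) + 1) * Real.exp (-(((l : ℝ) + 1) * u₁))) *
    ∫ u₂ in Ioi (y / u₁), Real.exp (-(((l : ℝ) + 1) * u₂)) * (A₂ + Real.log u₂) ^ j) with hG
  have hT : ∀ l : ℕ, (1 : ℝ) ≤ (l : ℝ) + 1 := fun l ↦ by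
    have : (0 : ℝ) ≤ l := l.cast_nonneg
    linarith
  have hT0 : ∀ l : ℕ, (0 : ℝ) < (l : ℝ) + 1 := fun l ↦ by linarith [hT l]
  -- (a) the terms are the integrals of `G l`
  have hterm : ∀ l : ℕ, ((l : ℝ) + 1)⁻¹ *
      KMV2000.logCutoffW i j (A₁ - Real.log ((l : ℝ) + 1)) (A₂ - Real.log ((l : ℝ) + 1)) (y * ((l : ℝ) + 1) ^ 2) =
      ∫ u₁ in Ioi (0 : ℝ), G l u₁ := by
    intro l
    rw [inv_mul_logCutoffW_scale (hT0 l) i j A₁ A₂ hy.le, ← integral_const_mul]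
    refine setIntegral_congr_fun measurableSet_Ioi fun u₁ _ ↦ ?_
    simp only [hG]
    ring
  -- (b) pointwise bound on `G l`
  have hGle : ∀ l : ℕ, ∀ u₁ ∈ Ioi (0 : ℝ),
      ‖G l u₁‖ ≤ (((l : ℝ) + 1) * ρ ^ l * M₂) * (Real.exp (-u₁) * |A₁ + Real.log u₁| ^ i) := by
    intro l u₁ hu₁
    have hu₁ : 0 < u₁ := hu₁
    have hz : 0 < y / u₁ := div_pos hy hu₁
    have htail := norm_expTail_le (hT l) A₂ j hz
    have hl0 : (0 : ℝ) ≤ l := l.cast_nonneg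
    -- `e^{-(l+1)u₁} e^{-l y/u₁} ≤ e^{-u₁} ρ^l`
    have hsq : Real.sqrt y ≤ u₁ + y / u₁ := by
      have := KMV2000.sqrt_le_half_add_div hy.le hu₁
      linarith
    have hexp : Real.exp (-(((l : ℝ) + 1) * u₁)) * Real.exp (-(((l : ℝ) + 1 - 1) * (y / u₁))) ≤
        Real.exp (-u₁) * ρ ^ l := by
      rw [hρ, ← Real.exp_nat_mul, ← Real.exp_add, ← Real.exp_add]
      refine Real.exp_le_exp.mpr ?_
      nlinarith [mul_le_mul_of_nonneg_left hsq hl0]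
    simp only [hG]
    rw [norm_mul, norm_mul, norm_pow, Real.norm_eq_abs, norm_mul, Real.norm_of_nonneg (hT0 l).le,
      Real.norm_of_nonneg (Real.exp_pos _).le]
    calc |A₁ + Real.log u₁| ^ i * (((l : ℝ) + 1) * Real.exp (-(((l : ℝ) + 1) * u₁)) *
          ‖∫ u₂ in Ioi (y / u₁), Real.exp (-(((l : ℝ) + 1) * u₂)) * (A₂ + Real.log u₂) ^ j‖)
        ≤ |A₁ + Real.log u₁| ^ i * (((l : ℝ) + 1) * Real.exp (-(((l : ℝ) + 1) * u₁)) *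
          (Real.exp (-(((l : ℝ) + 1 - 1) * (y / u₁))) * M₂)) := by gcongr
      _ = |A₁ + Real.log u₁| ^ i * ((l : ℝ) + 1) * M₂ *
          (Real.exp (-(((l : ℝ) + 1) * u₁)) * Real.exp (-(((l : ℝ) + 1 - 1) * (y / u₁)))) := by ring
      _ ≤ |A₁ + Real.log u₁| ^ i * ((l : ℝ) + 1) * M₂ * (Real.exp (-u₁) * ρ ^ l) := by gcongr
      _ = _ := by ring
  -- (c) measurability and integrability of `G l`
  have hGcont : ∀ l : ℕ, ContinuousOn (G l) (Ioi 0) := by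
    intro l u₁ hu₁
    have hu₁ : 0 < u₁ := hu₁
    refine ContinuousAt.continuousWithinAt ?_
    simp only [hG]
    have h1 : ContinuousAt (fun u : ℝ ↦ (A₁ + Real.log u) ^ i) u₁ :=
      (continuousAt_const.add (Real.continuousAt_log hu₁.ne')).pow i
    have h2 : ContinuousAt (fun u : ℝ ↦ ((l : ℝ) + 1) * Real.exp (-(((l : ℝ) + 1) * u))) u₁ := by fun_prop
    have h3 : ContinuousAt (fun u : ℝ ↦ ∫ u₂ in Ioi (y / u), Real.exp (-(((l : ℝ) + 1) * u₂)) *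
        (A₂ + Real.log u₂) ^ j) u₁ := by
      have hdiv : ContinuousAt (fun u : ℝ ↦ y / u) u₁ := continuousAt_const.div continuousAt_id hu₁.ne'
      exact ContinuousAt.comp (g := fun z : ℝ ↦ ∫ u₂ in Ioi z, Real.exp (-(((l : ℝ) + 1) * u₂)) *
        (A₂ + Real.log u₂) ^ j) (continuousAt_expTail (hT0 l) A₂ j (div_pos hy hu₁)) hdiv
    exact h1.mul (h2.mul h3)
  have hmaj : IntegrableOn (fun u₁ : ℝ ↦ Real.exp (-u₁) * |A₁ + Real.log u₁| ^ i) (Ioi 0) :=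
    integrableOn_exp_neg_mul_abs_logPow A₁ i
  have hGint : ∀ l : ℕ, Integrable (G l) (volume.restrict (Ioi 0)) := by
    intro l
    refine Integrable.mono' (hmaj.const_mul (((l : ℝ) + 1) * ρ ^ l * M₂))
      ((hGcont l).aestronglyMeasurable measurableSet_Ioi) ?_
    rw [ae_restrict_iff' measurableSet_Ioi]
    exact ae_of_all _ (hGle l)
  have hGsum : Summable fun l : ℕ ↦ ∫ u₁ in Ioi (0 : ℝ), ‖G l u₁‖ := by
    have hgeo : Summable fun l : ℕ ↦ (((l : ℝ) + 1) * ρ ^ l * M₂) * M₁ := by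
      have h1 : Summable fun l : ℕ ↦ ((l : ℝ) ^ 1 * ρ ^ l) :=
        summable_pow_mul_geometric_of_norm_lt_one 1 (by rwa [Real.norm_of_nonneg hρ0])
      have h2 : Summable fun l : ℕ ↦ ρ ^ l := summable_geometric_of_lt_one hρ0 hρ1
      have h3 : Summable fun l : ℕ ↦ ((l : ℝ) + 1) * ρ ^ l := by
        simpa [add_mul, pow_one] using h1.add h2
      simpa [mul_assoc, mul_comm, mul_left_comm] using (h3.mul_right (M₂ * M₁))
    refine Summable.of_nonneg_of_le (fun l ↦ integral_nonneg fun _ ↦ norm_nonneg _) (fun l ↦ ?_) hgeo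
    calc ∫ u₁ in Ioi (0 : ℝ), ‖G l u₁‖
        ≤ ∫ u₁ in Ioi (0 : ℝ), (((l : ℝ) + 1) * ρ ^ l * M₂) * (Real.exp (-u₁) * |A₁ + Real.log u₁| ^ i) :=
          setIntegral_mono_on (hGint l).norm (hmaj.const_mul _) measurableSet_Ioi (hGle l)
      _ = (((l : ℝ) + 1) * ρ ^ l * M₂) * M₁ := integral_const_mul _ _
  -- (d) the inner summation, pointwise in `u₁ > 0`
  have hinner : ∀ u₁ ∈ Ioi (0 : ℝ), ∑' l : ℕ, G l u₁ = (A₁ + Real.log u₁) ^ i *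
      ∫ u₂ in Ioi (y / u₁), Real.exp (-(u₁ + u₂)) / (1 - Real.exp (-(u₁ + u₂))) ^ 2 * (A₂ + Real.log u₂) ^ j := by
    intro u₁ hu₁
    have hu₁ : 0 < u₁ := hu₁
    have hz : 0 < y / u₁ := div_pos hy hu₁
    -- move the `u₁`-factor inside the inner integral
    have hGl : ∀ l : ℕ, G l u₁ = (A₁ + Real.log u₁) ^ i *
        ∫ u₂ in Ioi (y / u₁), ((l : ℝ) + 1) * Real.exp (-(((l : ℝ) + 1) * (u₁ + u₂))) * (A₂ + Real.log u₂) ^ j := by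
      intro l
      simp only [hG]
      congr 1
      rw [← integral_const_mul]
      refine setIntegral_congr_fun measurableSet_Ioi fun u₂ _ ↦ ?_
      rw [show -(((l : ℝ) + 1) * (u₁ + u₂)) = -(((l : ℝ) + 1) * u₁) + -(((l : ℝ) + 1) * u₂) by ring, Real.exp_add]
      ring
    simp_rw [hGl]
    rw [tsum_mul_left]
    congr 1
    -- interchange on `Ioi (y/u₁)`
    have hF_int : ∀ l : ℕ, Integrable (fun u₂ : ℝ ↦ ((l : ℝ) + 1) * Real.exp (-(((l : ℝ) + 1) * (u₁ + u₂))) *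
        (A₂ + Real.log u₂) ^ j) (volume.restrict (Ioi (y / u₁))) := fun l ↦ integrableOn_expInner (hT l) A₂ j hz u₁
    have hptw : ∀ l : ℕ, ∀ u₂ ∈ Ioi (y / u₁), ‖((l : ℝ) + 1) * Real.exp (-(((l : ℝ) + 1) * (u₁ + u₂))) *
        (A₂ + Real.log u₂) ^ j‖ ≤ (((l : ℝ) + 1) * Real.exp (-u₁) ^ (l + 1)) * (Real.exp (-u₂) * |A₂ + Real.log u₂| ^ j) := by
      intro l u₂ hu₂
      have hu₂ : 0 ≤ u₂ := (hz.trans hu₂).le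
      have hl0 : (0 : ℝ) ≤ l := l.cast_nonneg
      rw [norm_mul, norm_mul, Real.norm_of_nonneg (hT0 l).le, Real.norm_of_nonneg (Real.exp_pos _).le, norm_pow,
        Real.norm_eq_abs]
      have hexp : Real.exp (-(((l : ℝ) + 1) * (u₁ + u₂))) ≤ Real.exp (-u₁) ^ (l + 1) * Real.exp (-u₂) := by
        rw [← Real.exp_nat_mul, ← Real.exp_add]
        refine Real.exp_le_exp.mpr ?_
        push_cast
        nlinarith
      calc ((l : ℝ) + 1) * Real.exp (-(((l : ℝ) + 1) * (u₁ + u₂))) * |A₂ + Real.log u₂| ^ j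
          ≤ ((l : ℝ) + 1) * (Real.exp (-u₁) ^ (l + 1) * Real.exp (-u₂)) * |A₂ + Real.log u₂| ^ j := by gcongr
        _ = _ := by ring
    have hmaj₂ : IntegrableOn (fun u₂ : ℝ ↦ Real.exp (-u₂) * |A₂ + Real.log u₂| ^ j) (Ioi (y / u₁)) :=
      (integrableOn_exp_neg_mul_abs_logPow A₂ j).mono_set (Ioi_subset_Ioi hz.le)
    have hF_sum : Summable fun l : ℕ ↦ ∫ u₂ in Ioi (y / u₁), ‖((l : ℝ) + 1) *
        Real.exp (-(((l : ℝ) + 1) * (u₁ + u₂))) * (A₂ + Real.log u₂) ^ j‖ := by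
      have hr1 : ‖Real.exp (-u₁)‖ < 1 := by
        rw [Real.norm_of_nonneg (Real.exp_pos _).le]; exact Real.exp_lt_one_iff.mpr (by linarith)
      have hgeo0 : Summable fun n : ℕ ↦ (n : ℝ) * Real.exp (-u₁) ^ n :=
        (hasSum_coe_mul_geometric_of_norm_lt_one hr1).summable
      have hgeo : Summable fun l : ℕ ↦ (((l : ℝ) + 1) * Real.exp (-u₁) ^ (l + 1)) *
          ∫ u₂ in Ioi (y / u₁), Real.exp (-u₂) * |A₂ + Real.log u₂| ^ j := by
        have h := ((summable_nat_add_iff 1).mpr hgeo0).mul_right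
          (∫ u₂ in Ioi (y / u₁), Real.exp (-u₂) * |A₂ + Real.log u₂| ^ j)
        refine h.congr fun l ↦ ?_
        push_cast
        ring
      refine Summable.of_nonneg_of_le (fun l ↦ integral_nonneg fun _ ↦ norm_nonneg _) (fun l ↦ ?_) hgeo
      calc ∫ u₂ in Ioi (y / u₁), ‖((l : ℝ) + 1) * Real.exp (-(((l : ℝ) + 1) * (u₁ + u₂))) * (A₂ + Real.log u₂) ^ j‖
          ≤ ∫ u₂ in Ioi (y / u₁), (((l : ℝ) + 1) * Real.exp (-u₁) ^ (l + 1)) *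
              (Real.exp (-u₂) * |A₂ + Real.log u₂| ^ j) :=
            setIntegral_mono_on (hF_int l).norm (hmaj₂.const_mul _) measurableSet_Ioi (hptw l)
        _ = _ := integral_const_mul _ _
    rw [integral_tsum_of_summable_integral_norm hF_int hF_sum]
    refine setIntegral_congr_fun measurableSet_Ioi fun u₂ hu₂ ↦ ?_
    have hφ : 0 < u₁ + u₂ := by have : 0 < u₂ := hz.trans hu₂; linarith
    have hgeom := (hasSum_succ_mul_exp_neg hφ).mul_right ((A₂ + Real.log u₂) ^ j)
    rw [hgeom.tsum_eq]
  -- (e) assemble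
  have hmainsum := hasSum_integral_of_summable_integral_norm hGint hGsum
  have hval : ∫ u₁ in Ioi (0 : ℝ), ∑' l : ℕ, G l u₁ = ∫ u₁ in Ioi (0 : ℝ), (A₁ + Real.log u₁) ^ i *
      ∫ u₂ in Ioi (y / u₁), Real.exp (-(u₁ + u₂)) / (1 - Real.exp (-(u₁ + u₂))) ^ 2 * (A₂ + Real.log u₂) ^ j :=
    setIntegral_congr_fun measurableSet_Ioi hinner
  rw [show (fun l : ℕ ↦ ((l : ℝ) + 1)⁻¹ *
      KMV2000.logCutoffW i j (A₁ - Real.log ((l : ℝ) + 1)) (A₂ - Real.log ((l : ℝ) + 1)) (y * ((l : ℝ) + 1) ^ 2)) =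
      fun l : ℕ ↦ ∫ u₁ in Ioi (0 : ℝ), G l u₁ from funext hterm, ← hval]
  exact hmainsum

end Summit.Parity.GeneralizedHardyLittlewood.Theorems.MomentsBeyondDiagonal.DiagLines

end
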